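import Literature.IUT.LogThetaLattice.TensorPackets

/-!
# [IUTchIII] Proposition 3.1 (i), finite level — the statement with its binders IN THE HEADER
# (finding G-BINDER-DROP; companion of `TensorPackets.lean`)

S. Mochizuki, *Inter-universal Teichmüller theory III*, kurims manuscript (May 2020), §3, Proposition
3.1 (i), p. 93. abc-iut-L6-t5's finding G-BINDER-DROP (INBOX 2026-08-25T20:14:50Z, kernel witnesses
`HOME/staging/L6/L6-t5/audit/BinderDropWitness31.lean`, `…33.lean`): in `Prop31i_ringStructures'`
(TensorPackets.lean v3) the section-`variable` instances `[Fintype A]`, `[∀ α v, Module.Finite 𝕜 (L α v)]`,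
`[∀ α v, Algebra.IsSeparable 𝕜 (L α v)]` are not referenced by the `∃`-body and were therefore DROPPED by
Lean's section-variable rule — the primed def has the same type as the unprimed schema and is likewise a
recorded mis-typing, not a discharge target. This companion file (TensorPackets.lean is at its 399-line
budget) states the finite-level proposition with EVERY hypothesis as a HEADER binder, so that they are
part of the constant's type, and records that its body is literally that of `Prop31i_ringStructures`
(so abc-iut-L6-t5's discharge theorems `Prop31i_ringStructures_of_field` / `_of_isSeparable`, stated
under these very binders, prove it). Tag form [claim: Mochizuki2012, status: disputed].
-/

namespace Literature.IUT.LogThetaLattice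

universe u v v' w

/-- [IUTchIII] Proposition 3.1 (i) "(Ring Structures)", p. 93, FINITE-LEVEL statement with ALL its
hypotheses as HEADER binders (hence part of the type — check with `#check @Prop31i_ringStructures''`):
finite index sets `A` (capsule) and `Vfib` (places over `v_ℚ`), each `log(^α𝓕_v)` replaced by a finite
separable field extension `L α v` of `𝕜 = ℚ_{v_ℚ}`; then the tensor packet `⊗_α ⊕_v L α v` is a finite
product of fields. TRUE (finite étale `𝕜`-algebra ⇒ reduced artinian ⇒ `IsArtinianRing.equivPi`);
NOT instantiable at the Remark 3.1.1 (i) model `L α v = k̄` (no `Module.Finite` instance), where the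
model-level predicate is `Prop31i_locallyProductOfFields` (TensorPackets.lean v4).
[claim: Mochizuki2012, status: disputed] -/
def Prop31i_ringStructures'' (𝕜 : Type u) [Field 𝕜] {A : Type v} [Fintype A] {Vfib : Type v'}
    [Fintype Vfib] (L : A → Vfib → Type w) [∀ α v, Field (L α v)] [∀ α v, Algebra 𝕜 (L α v)]
    [∀ α v, Module.Finite 𝕜 (L α v)] [∀ α v, Algebra.IsSeparable 𝕜 (L α v)] : Prop :=
  ∃ (ι : Type (max u v v' w)) (_ : Fintype ι) (K : ι → Type (max u v v' w))
    (_ : ∀ i, Field (K i)), Nonempty (PacketN 𝕜 L ≃+* ∀ i, K i)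

/-- `''` has literally the body of the schema `Prop31i_ringStructures` (instantiated at field data), so a
proof of the latter under the finite/separable hypotheses — abc-iut-L6-t5's companion theorems — proves
`''` — PROVED (`Iff.rfl`). [claim: Mochizuki2012, status: disputed] -/
theorem Prop31i_ringStructures''_iff (𝕜 : Type u) [Field 𝕜] {A : Type v} [Fintype A] [DecidableEq A]
    {Vfib : Type v'} [Fintype Vfib] [DecidableEq Vfib] (L : A → Vfib → Type w) [∀ α v, Field (L α v)]
    [∀ α v, Algebra 𝕜 (L α v)] [∀ α v, Module.Finite 𝕜 (L α v)] [∀ α v, Algebra.IsSeparable 𝕜 (L α v)] :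
    Prop31i_ringStructures'' 𝕜 L ↔ Prop31i_ringStructures 𝕜 (fun α v => L α v) :=
  Iff.rfl

end Literature.IUT.LogThetaLattice
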